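import Summits.QuantumFields.BalabanUV.InfraRed.StrongCouplingDimensionalCurvature
import Summits.QuantumFields.BalabanUV.InfraRed.StrongCouplingDimensionalPoincare
import Summits.QuantumFields.BalabanUV.InfraRed.StrongCouplingSixFifthsWindow

/-!
# Strong-coupling front, J-SC12 (part 3/3): the DIMENSIONAL WINDOW `696 β_W² < 13` (`β_W < 0.13667`),
hypothesis-free — observatory of the non-perturbative crossover; no mass-gap claim

IR-3 v2 TWO-FRONT CROSSOVER LEDGER, front SC (`β₀`), SU(2), `d = 4`, Wilson normalisation `β_W = 4/g²`
(`R = 3β_W/2`, `κ = 6β_W`).  observatory of the non-perturbative crossover; no mass-gap claim.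

ABSOLUTE RULE. No internally-minted statement may enter as a cited fact. Every hypothesis is either
kernel-proved in this package or a verbatim quotation of a PUBLISHED theorem with page reference. The
manuscript(s) under audit are NOT citable for their own disputed steps — they are the thing under
adjudication; programme-internal (2001/route/tribunal) claims are never citable.  THIS FILE HAS NO
HYPOTHESES: every statement below is kernel-proved from the tree; names of published results appear as
ATTRIBUTION only (Bochner–Lichnerowicz–Bakry–Émery curvature–dimension argument).

WHAT THIS FILE PROVES (hypothesis-free, kernel-checked):
* `var_tilted_le_of_poincare_K`: the tree's Lipschitz wrapper `haarPoincare_SU` with an abstract constant;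
* `su2_var_tilted_le_dim`: `Var_{ν_B}(ψ) ≤ M²/K'`, `K' = (8t - t² - 32‖B‖_F²)(t+3)/(8t(t+2))`, any `t > 0`
  with positive numerator (`ν_B ∝ exp(2 Re tr(gB)) dg` on `SU(2)`, `|ψ(a)-ψ(b)| ≤ M‖a-b‖_F`);
* `oneLinkPoincareSU2_dim`: `768R² < 117 → OneLinkPoincareSU2 R (112/(117 - 768R²))` (`t = 3/2`,
  `‖B‖_F² ≤ 2‖B‖_op²`), which is SMALLER than Bakry–Émery's `1/(1 - 2R)` for all `0 ≤ R < 5/16`;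
* via the landed plug-in `oneLinkKRModulusSU2_of_poincare_fifth` (J-SC11) and the tree's doors:
  `su2_strongCouplingFront_dim`, `su2_dlrMassGapAt_dim`, `su2_latticeMassGap_dim` under `0 ≤ β_W`,
  `696 β_W² < 13`; decimal instances at `β_W = 0.1366` and at `g = 2` (`β_W = 2/15`).
OWNED NUMBER (SC front, hypothesis-free, SU(2), d = 4): `β_W ≤ 0.124` (J-SC8, Bakry–Émery) becomes
`β_W < √(13/696) = 0.13667`; the ceiling of the one-link Dobrushin method stays `2/9` (J-SC9) and the
conditional reach `√3/9` under `OneLinkPoincareSU2 (3/10) (2/3)` (J-SC11) is untouched.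
-/

noncomputable section

open scoped Matrix ComplexConjugate BigOperators Matrix.Norms.Frobenius ContDiff Topology InnerProductSpace
open Matrix Complex Finset MeasureTheory Filter ProbabilityTheory
open Literature.MathematicalPhysics.QuantumFieldTheory
open Literature.MathematicalPhysics.QuantumFieldTheory.SUNBakryEmery

namespace Summit.QuantumFields.BalabanUV.InfraRed.StrongCouplingDimensionalVariance

open Summit.QuantumFields.BalabanUV.InfraRed.StrongCouplingDimensionalCurvature
open Summit.QuantumFields.BalabanUV.InfraRed.StrongCouplingDimensionalPoincare

variable {N : ℕ}

/-- **The one-link Poincaré inequality on `SU(N)` in the Lipschitz form, from a smooth Poincaré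
inequality with an ABSTRACT constant** (the tree's `SUNBakryEmery.haarPoincare_SU` with its
Bakry–Émery constant `N(1/2 - ‖B‖_op)` replaced by any `K > 0` for which
`K ∫ e^S (F - m_F)² ≤ ∫ e^S Γ(F,F)` holds for all smooth `F`, `S = N Re tr(· B)`): for `ψ` with
`|ψ(a) - ψ(b)| ≤ M ‖a - b‖_F`, `Var_{ν_B}(ψ) ≤ M²/K`, `ν_B(dg) ∝ exp(N Re tr(g B)) dg`. Proof verbatim
from the tree (smooth approximation of Lipschitz functions with `Γ ≤ M²`, ε-argument). [folklore] -/
theorem var_tilted_le_of_poincare_K (hN : N ≠ 0) (B : Matrix (Fin N) (Fin N) ℂ) {K : ℝ} (hKpos : 0 < K)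
    (hP : ∀ {F : Matrix (Fin N) (Fin N) ℂ → ℝ}, ContDiff ℝ ∞ F →
      K * ∫ g : SUN N, Real.exp (pot (N : ℝ) B g) * (F g -
          (∫ g : SUN N, Real.exp (pot (N : ℝ) B g) * F g ∂(haarSU N)) /
            (∫ g : SUN N, Real.exp (pot (N : ℝ) B g) ∂(haarSU N))) ^ 2 ∂(haarSU N) ≤
        ∫ g : SUN N, Real.exp (pot (N : ℝ) B g) * Gam F F g ∂(haarSU N))
    (ψ : Matrix.specialUnitaryGroup (Fin N) ℂ → ℝ) (M : ℝ) (hM : 0 ≤ M)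
    (hψ : ∀ a b, |ψ a - ψ b| ≤ M * suFrobDist a b) :
    Var[ψ; (haarProbability (Matrix.specialUnitaryGroup (Fin N) ℂ)).tilted
        fun g => (N : ℝ) * ((g : Matrix (Fin N) (Fin N) ℂ) * B).trace.re] ≤ M ^ 2 / K := by
  set S : Matrix (Fin N) (Fin N) ℂ → ℝ := pot (N : ℝ) B with hSdef
  have hS : ContDiff ℝ ∞ S := contDiff_pot _ B
  have hSc : Continuous fun g : SUN N => S g := continuous_restrict hS
  have hwc : Continuous fun g : SUN N => Real.exp (S g) := Real.continuous_exp.comp hSc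
  set Z : ℝ := ∫ g : SUN N, Real.exp (S g) ∂(haarSU N) with hZ
  have hZpos : 0 < Z := integral_exp_pos (integrable_of_continuous_SUN hwc _)
  have hψc : Continuous ψ := continuous_of_lipschitz_suFrobDist hψ
  -- the variance as a weighted integral
  set m : ℝ := (∫ g : SUN N, Real.exp (S g) * ψ g ∂(haarSU N)) / Z with hmdef
  have hmean : ∫ g, ψ g ∂((haarSU N).tilted fun g => S g) = m := by rw [integral_tilted_eq_div]
  have hvar : Var[ψ; (haarSU N).tilted fun g => S g] =
      (∫ g : SUN N, Real.exp (S g) * (ψ g - m) ^ 2 ∂(haarSU N)) / Z := by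
    rw [ProbabilityTheory.variance_eq_integral hψc.aemeasurable, hmean, integral_tilted_eq_div]
  change Var[ψ; (haarSU N).tilted fun g => S g] ≤ M ^ 2 / K
  rw [hvar, div_le_div_iff₀ hZpos hKpos]
  -- bounds for `ψ`
  obtain ⟨D, hD⟩ : ∃ D, ∀ g : SUN N, |ψ g| ≤ D := by
    obtain ⟨D, hD⟩ := (isCompact_univ (X := SUN N)).exists_bound_of_continuousOn hψc.continuousOn
    exact ⟨D, fun g => (Real.norm_eq_abs _).symm.le.trans (hD g (Set.mem_univ _))⟩
  have hD0 : 0 ≤ D := (abs_nonneg _).trans (hD 1)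
  have hwint : ∀ {f : SUN N → ℝ}, Continuous f → Integrable (fun g : SUN N => Real.exp (S g) * f g) (haarSU N) :=
    fun hf => integrable_of_continuous_SUN (hwc.mul hf) _
  -- weighted averages are bounded by sup norms
  have havg : ∀ {f : SUN N → ℝ} (hf : Continuous f) {C : ℝ}, (∀ g, |f g| ≤ C) →
      |(∫ g : SUN N, Real.exp (S g) * f g ∂(haarSU N)) / Z| ≤ C := by
    intro f hf C hC
    rw [abs_div, abs_of_pos hZpos, div_le_iff₀ hZpos]
    calc |∫ g : SUN N, Real.exp (S g) * f g ∂(haarSU N)| ≤ ∫ g : SUN N, |Real.exp (S g) * f g| ∂(haarSU N) :=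
          abs_integral_le_integral_abs
      _ ≤ ∫ g : SUN N, Real.exp (S g) * C ∂(haarSU N) := by
          refine integral_mono (hwint hf).abs (hwint continuous_const) fun g => ?_
          rw [abs_mul, abs_of_pos (Real.exp_pos _)]
          exact mul_le_mul_of_nonneg_left (hC g) (Real.exp_pos _).le
      _ = C * Z := by rw [integral_mul_const, hZ, mul_comm]
  have hm : |m| ≤ D := havg hψc hD
  -- the ε-argument
  refine le_of_forall_pos_le_add fun δ hδ => ?_
  have hden : 0 < 2 * (4 * D + 2) * Z * K + 1 := by positivity
  set ε : ℝ := min 1 (δ / (2 * (4 * D + 2) * Z * K + 1)) with hεdef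
  have hε : 0 < ε := lt_min one_pos (div_pos hδ hden)
  have hε1 : ε ≤ 1 := min_le_left _ _
  have hεδ : 2 * ε * (4 * D + 2) * Z * K ≤ δ := by
    have h1 : ε ≤ δ / (2 * (4 * D + 2) * Z * K + 1) := min_le_right _ _
    rw [le_div_iff₀ hden] at h1
    nlinarith [hZpos, hD0, hε, hKpos]
  obtain ⟨F, hF, hΓF, hFψ⟩ := exists_smooth_approx hM hψ hε hN
  have hFc : Continuous fun g : SUN N => F g := continuous_restrict hF
  -- Poincaré for `F`
  set mF : ℝ := (∫ g : SUN N, Real.exp (S g) * F g ∂(haarSU N)) / Z with hmFdef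
  have hPF : K * ∫ g : SUN N, Real.exp (S g) * (F g - mF) ^ 2 ∂(haarSU N) ≤ M ^ 2 * Z := by
    have h := hP hF
    refine h.trans ?_
    calc ∫ g : SUN N, Real.exp (pot (N : ℝ) B g) * Gam F F g ∂(haarSU N)
        ≤ ∫ g : SUN N, Real.exp (S g) * M ^ 2 ∂(haarSU N) := by
          refine integral_mono (hwint (continuous_restrict (contDiff_Gam hF hF))) (hwint continuous_const) fun g => ?_
          exact mul_le_mul_of_nonneg_left (hΓF g) (Real.exp_pos _).le
      _ = M ^ 2 * Z := by rw [integral_mul_const, hZ, mul_comm]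
  -- compare `ψ - m` with `F - mF`
  have hmm : |mF - m| ≤ ε := by
    have h : mF - m = (∫ g : SUN N, Real.exp (S g) * (F g - ψ g) ∂(haarSU N)) / Z := by
      rw [hmFdef, hmdef, ← sub_div, ← integral_sub (hwint hFc) (hwint hψc)]
      congr 1
      exact integral_congr_ae (ae_of_all _ fun g => by ring)
    rw [h]
    exact havg (hFc.sub hψc) fun g => hFψ g
  have hpt : ∀ g : SUN N, Real.exp (S g) * (ψ g - m) ^ 2 ≤
      Real.exp (S g) * (F g - mF) ^ 2 + Real.exp (S g) * (2 * ε * (4 * D + 2)) := by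
    intro g
    rw [← mul_add]
    refine mul_le_mul_of_nonneg_left ?_ (Real.exp_pos _).le
    have ha : |ψ g - m| ≤ 2 * D := by
      have := abs_sub (ψ g) m
      linarith [hD g, hm]
    have hab : |(ψ g - m) - (F g - mF)| ≤ 2 * ε := by
      have e : (ψ g - m) - (F g - mF) = -(F g - ψ g) + (mF - m) := by ring
      rw [e]
      refine (abs_add_le _ _).trans ?_
      rw [abs_neg]
      linarith [hFψ g, hmm]
    have hb : |F g - mF| ≤ 2 * D + 2 * ε := by
      have h1 := abs_sub_abs_le_abs_sub (F g - mF) (ψ g - m)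
      have h2 : |(F g - mF) - (ψ g - m)| ≤ 2 * ε := by rw [abs_sub_comm]; exact hab
      linarith
    have key : (ψ g - m) ^ 2 - (F g - mF) ^ 2 ≤ 2 * ε * (4 * D + 2) := by
      have e : (ψ g - m) ^ 2 - (F g - mF) ^ 2 = ((ψ g - m) - (F g - mF)) * ((ψ g - m) + (F g - mF)) := by ring
      rw [e]
      refine (le_abs_self _).trans ?_
      rw [abs_mul]
      have hsum : |(ψ g - m) + (F g - mF)| ≤ 4 * D + 2 := by
        refine (abs_add_le _ _).trans ?_
        nlinarith [ha, hb, hε1]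
      calc |ψ g - m - (F g - mF)| * |ψ g - m + (F g - mF)| ≤ (2 * ε) * (4 * D + 2) :=
            mul_le_mul hab hsum (abs_nonneg _) (by positivity)
        _ = 2 * ε * (4 * D + 2) := by ring
    linarith
  have j0 : Integrable (fun g : SUN N => Real.exp (S g) * (ψ g - m) ^ 2) (haarSU N) :=
    hwint ((hψc.sub continuous_const).pow 2)
  have j1 : Integrable (fun g : SUN N => Real.exp (S g) * (F g - mF) ^ 2) (haarSU N) :=
    hwint ((hFc.sub continuous_const).pow 2)
  have j2 : Integrable (fun g : SUN N => Real.exp (S g) * (2 * ε * (4 * D + 2))) (haarSU N) := hwint continuous_const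
  have j12 : Integrable (fun g : SUN N => Real.exp (S g) * (F g - mF) ^ 2 + Real.exp (S g) * (2 * ε * (4 * D + 2)))
      (haarSU N) := j1.add j2
  have hmono : ∫ g : SUN N, Real.exp (S g) * (ψ g - m) ^ 2 ∂(haarSU N) ≤
      ∫ g : SUN N, (Real.exp (S g) * (F g - mF) ^ 2 + Real.exp (S g) * (2 * ε * (4 * D + 2))) ∂(haarSU N) :=
    integral_mono j0 j12 hpt
  have hsplit : ∫ g : SUN N, (Real.exp (S g) * (F g - mF) ^ 2 + Real.exp (S g) * (2 * ε * (4 * D + 2))) ∂(haarSU N) =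
      ∫ g : SUN N, Real.exp (S g) * (F g - mF) ^ 2 ∂(haarSU N) + Z * (2 * ε * (4 * D + 2)) := by
    rw [integral_add j1 j2, integral_mul_const]
  have h1 : (∫ g : SUN N, Real.exp (S g) * (F g - mF) ^ 2 ∂(haarSU N)) * K ≤ M ^ 2 * Z := by
    rw [mul_comm]; exact hPF
  have h2 : Z * (2 * ε * (4 * D + 2)) * K ≤ δ := by
    calc Z * (2 * ε * (4 * D + 2)) * K = 2 * ε * (4 * D + 2) * Z * K := by ring
      _ ≤ δ := hεδ
  calc (∫ g : SUN N, Real.exp (S g) * (ψ g - m) ^ 2 ∂(haarSU N)) * K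
      ≤ (∫ g : SUN N, Real.exp (S g) * (F g - mF) ^ 2 ∂(haarSU N) + Z * (2 * ε * (4 * D + 2))) * K := by
        rw [← hsplit]; exact mul_le_mul_of_nonneg_right hmono hKpos.le
    _ = (∫ g : SUN N, Real.exp (S g) * (F g - mF) ^ 2 ∂(haarSU N)) * K + Z * (2 * ε * (4 * D + 2)) * K := add_mul _ _ _
    _ ≤ M ^ 2 * Z + δ := add_le_add h1 h2


/-- **The dimensional one-link Poincaré inequality on `SU(2)`** (hypothesis-free): for
`B ∈ M₂(ℂ)`, `t > 0` with `A := 8t - t² - 32‖B‖_F² > 0` and `ψ` with `|ψ(a) - ψ(b)| ≤ M‖a - b‖_F`,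
`Var_{ν_B}(ψ) ≤ M² / K'`, `K' = A(t + 3)/(8t(t + 2))`, `ν_B(dg) ∝ exp(2 Re tr(g B)) dg` — the curvature
constant of the condition `CD(1 - t/8 - 4‖B‖_F²/t, t + 3)` in place of Bakry–Émery's `1 - 2‖B‖_op`.
[folklore] -/
theorem su2_var_tilted_le_dim (B : Matrix (Fin 2) (Fin 2) ℂ) {t : ℝ} (ht : 0 < t)
    (hA : 0 < 8 * t - t ^ 2 - 8 * ((2 : ℝ) ^ 2 * frobNorm B ^ 2))
    (ψ : Matrix.specialUnitaryGroup (Fin 2) ℂ → ℝ) (M : ℝ) (hM : 0 ≤ M)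
    (hψ : ∀ a b, |ψ a - ψ b| ≤ M * suFrobDist a b) :
    Var[ψ; (haarProbability (Matrix.specialUnitaryGroup (Fin 2) ℂ)).tilted
        fun g => (2 : ℝ) * ((g : Matrix (Fin 2) (Fin 2) ℂ) * B).trace.re] ≤
      M ^ 2 / ((8 * t - t ^ 2 - 8 * ((2 : ℝ) ^ 2 * frobNorm B ^ 2)) * (t + 3) / (8 * t * (t + 2))) := by
  set K : ℝ := (8 * t - t ^ 2 - 8 * ((2 : ℝ) ^ 2 * frobNorm B ^ 2)) * (t + 3) / (8 * t * (t + 2)) with hKdef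
  have hKpos : 0 < K := by positivity
  have hGam : ∀ {v : Matrix (Fin 2) (Fin 2) ℂ → ℝ}, ContDiff ℝ ∞ v →
      K * ∫ g : SUN 2, Real.exp (pot (2 : ℝ) B g) * Gam v v g ∂(haarSU 2) ≤
        ∫ g : SUN 2, Real.exp (pot (2 : ℝ) B g) * genL (pot (2 : ℝ) B) v g ^ 2 ∂(haarSU 2) := by
    intro v hv
    have h := integral_exp_mul_Gam_le_dim (2 : ℝ) B hv ht
    have hpos : (0 : ℝ) < 8 * t * (t + 2) := by positivity
    show K * ∫ g : SUN 2, Real.exp ((2 : ℝ) * ((g : Matrix (Fin 2) (Fin 2) ℂ) * B).trace.re) * Gam v v g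
        ∂(haarProbability (SUN 2)) ≤
      ∫ g : SUN 2, Real.exp ((2 : ℝ) * ((g : Matrix (Fin 2) (Fin 2) ℂ) * B).trace.re) *
        genL (fun Q => (2 : ℝ) * (Q * B).trace.re) v g ^ 2 ∂(haarProbability (SUN 2))
    rw [hKdef, div_mul_eq_mul_div, div_le_iff₀ hpos]
    linarith
  have h2 : ((2 : ℕ) : ℝ) = 2 := by norm_num
  have hP : ∀ {F : Matrix (Fin 2) (Fin 2) ℂ → ℝ}, ContDiff ℝ ∞ F →
      K * ∫ g : SUN 2, Real.exp (pot ((2 : ℕ) : ℝ) B g) * (F g -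
          (∫ g : SUN 2, Real.exp (pot ((2 : ℕ) : ℝ) B g) * F g ∂(haarSU 2)) /
            (∫ g : SUN 2, Real.exp (pot ((2 : ℕ) : ℝ) B g) ∂(haarSU 2))) ^ 2 ∂(haarSU 2) ≤
        ∫ g : SUN 2, Real.exp (pot ((2 : ℕ) : ℝ) B g) * Gam F F g ∂(haarSU 2) := by
    rw [h2]
    intro F hF
    exact poincare_pot_K two_ne_zero (2 : ℝ) B hKpos hGam hF
  have hvar := var_tilted_le_of_poincare_K (N := 2) two_ne_zero B hKpos hP ψ M hM hψ
  rw [h2] at hvar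
  exact hvar

end Summit.QuantumFields.BalabanUV.InfraRed.StrongCouplingDimensionalVariance

namespace Summit.QuantumFields.BalabanUV.InfraRed.StrongCouplingDimensionalWindow

open ProbabilityTheory
open Literature.Probability.LatticeModels
open Literature.MathematicalPhysics.QuantumLattice (fundamentalRep fundamentalLatticeRep)
open Literature.MathematicalPhysics.QuantumFieldTheory.Balaban1983to89
open Literature.MathematicalPhysics.QuantumFieldTheory.Balaban1983to89.StrongCouplingDobrushinWindow
open Literature.MathematicalPhysics.QuantumFieldTheory.Balaban1983to89.StrongCouplingTorusWindow
open Literature.MathematicalPhysics.QuantumFieldTheory.Balaban1983to89.StrongCouplingKernelWindow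
open Literature.MathematicalPhysics.QuantumFieldTheory.Balaban1983to89.StrongCouplingOpenWindow
open Summit.QuantumFields.BalabanUV.InfraRed.StrongCouplingDimensionalVariance
open Summit.QuantumFields.BalabanUV.InfraRed.StrongCouplingPoincareWindow
open Summit.QuantumFields.BalabanUV.InfraRed.StrongCouplingSixFifthsWindow

/-! ## Part A: the dimensional Poincaré constant in the ledger's units -/

/-- `‖B‖_F² ≤ 2‖B‖_op²` on `M₂(ℂ)` (`‖B·1‖_F ≤ ‖B‖_op ‖1‖_F`, `‖1‖_F² = 2`). [folklore] -/
private theorem frobNorm_sq_le_two_mul_matrixOpNorm_sq (B : Matrix (Fin 2) (Fin 2) ℂ) :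
    frobNorm B ^ 2 ≤ 2 * matrixOpNorm B ^ 2 := by
  have h1 : frobNorm (1 : Matrix (Fin 2) (Fin 2) ℂ) ^ 2 = 2 := by
    rw [frobNorm_sq_of_mem_unitaryGroup (Submonoid.one_mem _)]; simp
  have h := SUNBakryEmery.frobNorm_mul_le_matrixOpNorm_mul B 1
  rw [Matrix.mul_one] at h
  calc frobNorm B ^ 2 ≤ (matrixOpNorm B * frobNorm (1 : Matrix (Fin 2) (Fin 2) ℂ)) ^ 2 :=
        pow_le_pow_left₀ (frobNorm_nonneg _) h 2
    _ = 2 * matrixOpNorm B ^ 2 := by rw [mul_pow, h1]; ring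

/-- **The dimensional one-link Poincaré constant** (hypothesis-free): for `768 R² < 117`
(`R < 0.3903`), `OneLinkPoincareSU2 R (112/(117 - 768 R²))` — the `t = 3/2` point of the
curvature–dimension family `CD(1 - t/8 - 4‖B‖_F²/t, t + 3)` with `‖B‖_F² ≤ 2R²`; it beats the
Bakry–Émery constant `1/(1 - 2R)` (`oneLinkPoincareSU2_bakryEmery`) for every `R > 0`
(`112(1 - 2R) < 117 - 768R²` iff `768R² - 224R + 5 < 0`, i.e. `0.024 < R < 0.268`, and below `0.024`
both are `< 1.06`; at `R = 3β_W/2 = 0.2` they read `1.5385` vs `1.6667`). [folklore] -/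
theorem oneLinkPoincareSU2_dim {R : ℝ} (hR : 768 * R ^ 2 < 117) : OneLinkPoincareSU2 R (112 / (117 - 768 * R ^ 2)) := by
  intro B hB ψ M hM hψ
  have hB0 : 0 ≤ matrixOpNorm B := matrixOpNorm_nonneg B
  have hBR : matrixOpNorm B ^ 2 ≤ R ^ 2 := pow_le_pow_left₀ hB0 hB 2
  have hF : frobNorm B ^ 2 ≤ 2 * R ^ 2 := (frobNorm_sq_le_two_mul_matrixOpNorm_sq B).trans (by linarith)
  have hA : 0 < 8 * (3 / 2 : ℝ) - (3 / 2) ^ 2 - 8 * ((2 : ℝ) ^ 2 * frobNorm B ^ 2) := by nlinarith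
  have hvar := su2_var_tilted_le_dim B (t := 3 / 2) (by norm_num) hA ψ M hM hψ
  have hKeq : (8 * (3 / 2 : ℝ) - (3 / 2) ^ 2 - 8 * ((2 : ℝ) ^ 2 * frobNorm B ^ 2)) * (3 / 2 + 3) /
      (8 * (3 / 2) * (3 / 2 + 2)) = 117 / 112 - 24 * frobNorm B ^ 2 / 7 := by ring
  have hK : (117 - 768 * R ^ 2) / 112 ≤ (8 * (3 / 2 : ℝ) - (3 / 2) ^ 2 - 8 * ((2 : ℝ) ^ 2 * frobNorm B ^ 2)) *
      (3 / 2 + 3) / (8 * (3 / 2) * (3 / 2 + 2)) := by rw [hKeq]; linarith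
  have hpos : 0 < (117 - 768 * R ^ 2) / 112 := div_pos (by linarith) (by norm_num)
  calc Var[ψ; (haarProbability (Matrix.specialUnitaryGroup (Fin 2) ℂ)).tilted
          (Literature.MathematicalPhysics.QuantumFieldTheory.Balaban1983to89.StrongCouplingVarianceWindow.pot B)]
        ≤ M ^ 2 / ((8 * (3 / 2 : ℝ) - (3 / 2) ^ 2 - 8 * ((2 : ℝ) ^ 2 * frobNorm B ^ 2)) * (3 / 2 + 3) /
          (8 * (3 / 2) * (3 / 2 + 2))) := hvar
    _ ≤ M ^ 2 / ((117 - 768 * R ^ 2) / 112) := div_le_div_of_nonneg_left (sq_nonneg M) hpos hK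
    _ = 112 / (117 - 768 * R ^ 2) * M ^ 2 := by rw [div_div_eq_mul_div]; ring

/-! ## Part B: the window and the ledger doors (hypothesis-free) -/

/-- The dimensional window in closed form: for `0 ≤ β_W` with `696 β_W² < 13`,
`81 β_W² · 112/(117 - 1728 β_W²) < 2` (the two are equivalent; `1728 β_W² = 768 (3β_W/2)²`). [folklore] -/
theorem su2_window_dim {βW : ℝ} (hw : 696 * βW ^ 2 < 13) :
    81 * βW ^ 2 * (112 / (117 - 1728 * βW ^ 2)) < 2 := by
  have hden : 0 < 117 - 1728 * βW ^ 2 := by nlinarith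
  rw [← mul_div_assoc, div_lt_iff₀ hden]
  nlinarith

/-- **The dimensional one-link KR modulus** (hypothesis-free): for `0 ≤ β_W`, `696 β_W² < 13`,
`OneLinkKRModulusSU2 β_W (√(2c)/4)` with `c = 112/(117 - 1728 β_W²)`. [folklore] -/
theorem oneLinkKRModulusSU2_dim {βW : ℝ} (hw : 696 * βW ^ 2 < 13) :
    OneLinkKRModulusSU2 βW (Real.sqrt (2 * (112 / (117 - 1728 * βW ^ 2))) / 4) := by
  have h5 : βW ≤ 1 / 5 := by nlinarith
  have hden : 0 < 117 - 1728 * βW ^ 2 := by nlinarith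
  have hc : (0 : ℝ) < 112 / (117 - 1728 * βW ^ 2) := div_pos (by norm_num) hden
  have hP := oneLinkPoincareSU2_dim (R := 3 * βW / 2) (by nlinarith)
  have e : 768 * (3 * βW / 2) ^ 2 = 1728 * βW ^ 2 := by ring
  rw [e] at hP
  exact oneLinkKRModulusSU2_of_poincare_fifth h5 hc hP

/-- **SC-b, dimensional window** (hypothesis-free): `0 ≤ β₀W → 696 β₀W² < 13 →
StrongCouplingFront (fundamentalLatticeRep 2) (β₀W/2)` — i.e. `β₀W < √(13/696) = 0.13667`, past the
Bakry–Émery window `β₀W ≤ 0.12440` (J-SC8) and past `g = 2` (`β_W = 2/15`). [folklore] -/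
theorem su2_strongCouplingFront_dim {β₀W : ℝ} (h0 : 0 ≤ β₀W) (hw : 696 * β₀W ^ 2 < 13) :
    CrossoverLedger.StrongCouplingFront (fundamentalLatticeRep 2) (β₀W / 2) := by
  have hden : 0 < 117 - 1728 * β₀W ^ 2 := by nlinarith
  have hc : (0 : ℝ) < 112 / (117 - 1728 * β₀W ^ 2) := div_pos (by norm_num) hden
  exact su2_strongCouplingFront_of_oneLinkKRModulus (by positivity) (oneLinkKRModulusSU2_dim hw)
    ((su2_window_iff_of_poincare h0 hc).2 (su2_window_dim hw))

/-- **SC-a, dimensional window** (hypothesis-free): `0 ≤ βW → 696 βW² < 13 → DLRMassGapAt 4 2 (βW/4)`. [folklore] -/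
theorem su2_dlrMassGapAt_dim {βW : ℝ} (h0 : 0 ≤ βW) (hw : 696 * βW ^ 2 < 13) : DLRMassGapAt 4 2 (βW / 4) := by
  have hden : 0 < 117 - 1728 * βW ^ 2 := by nlinarith
  have hc : (0 : ℝ) < 112 / (117 - 1728 * βW ^ 2) := div_pos (by norm_num) hden
  exact su2_dlrMassGapAt_of_oneLinkKRModulus h0 (by positivity) (oneLinkKRModulusSU2_dim hw)
    ((su2_window_iff_of_poincare h0 hc).2 (su2_window_dim hw))

/-- **SC-c, dimensional window** (hypothesis-free): `0 ≤ βW → 696 βW² < 13 →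
LatticeMassGap (fundamentalRep (Fin 2)) (βW/2) (krRate (18 βW √(2c)/4))`, `c = 112/(117 - 1728 βW²)`. [folklore] -/
theorem su2_latticeMassGap_dim {βW : ℝ} (h0 : 0 ≤ βW) (hw : 696 * βW ^ 2 < 13) :
    CrossoverLedger.LatticeMassGap (fundamentalRep (Fin 2)) (βW / 2)
      (krRate (18 * βW * (Real.sqrt (2 * (112 / (117 - 1728 * βW ^ 2))) / 4))) := by
  have hden : 0 < 117 - 1728 * βW ^ 2 := by nlinarith
  have hc : (0 : ℝ) < 112 / (117 - 1728 * βW ^ 2) := div_pos (by norm_num) hden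
  exact su2_latticeMassGap_of_oneLinkKRModulusSU2 h0 (by positivity) (oneLinkKRModulusSU2_dim hw)
    ((su2_window_iff_of_poincare h0 hc).2 (su2_window_dim hw))

/-! ## Part C: decimal headline instances (β_W = 0.1366, i.e. g² = 4/β_W = 29.28) -/

/-- SC-b at `β₀W = 0.1366` (hypothesis-free; `696 · 0.1366² = 12.987 < 13`). [folklore] -/
theorem su2_strongCouplingFront_01366 : CrossoverLedger.StrongCouplingFront (fundamentalLatticeRep 2) ((0.1366 : ℝ) / 2) :=
  su2_strongCouplingFront_dim (by norm_num) (by norm_num)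

/-- SC-a at `βW = 0.1366` (hypothesis-free). [folklore] -/
theorem su2_dlrMassGapAt_01366 : DLRMassGapAt 4 2 ((0.1366 : ℝ) / 4) :=
  su2_dlrMassGapAt_dim (by norm_num) (by norm_num)

/-- SC-c at `βW = 0.1366` (hypothesis-free). [folklore] -/
theorem su2_latticeMassGap_01366 : CrossoverLedger.LatticeMassGap (fundamentalRep (Fin 2)) ((0.1366 : ℝ) / 2)
    (krRate (18 * (0.1366 : ℝ) * (Real.sqrt (2 * (112 / (117 - 1728 * (0.1366 : ℝ) ^ 2))) / 4))) :=
  su2_latticeMassGap_dim (by norm_num) (by norm_num)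

/-- SC-b at `g = 2`, i.e. `β₀W = 2/15 = 0.1333…` (hypothesis-free) — the first integer bare coupling
past the Bakry–Émery window. [folklore] -/
theorem su2_strongCouplingFront_two_fifteenths :
    CrossoverLedger.StrongCouplingFront (fundamentalLatticeRep 2) ((2 / 15 : ℝ) / 2) :=
  su2_strongCouplingFront_dim (by norm_num) (by norm_num)

end Summit.QuantumFields.BalabanUV.InfraRed.StrongCouplingDimensionalWindow

end
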